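import Literature.RingTheory.FormalGroups.LogTypeSubstCongruence
import Literature.NumberTheory.EllipticCurves.FormalGroupLogHomAbelProofs
import Literature.NumberTheory.EllipticCurves.FormalGroupHasseInvariantProofs
import Literature.NumberTheory.EllipticCurves.FormalLogExpBaseChangeProofs
import Literature.NumberTheory.EllipticCurves.FormalGroupLogSeriesUltrametric
import HarnessLib

/-!
# `log_{E₀}` is a function OF THE SECOND KIND on every formal group congruent to `Ê₀`: the `⊕_W`-coboundary of `log_{E₀}` has
# BOUNDED coefficients when `W ≡ E₀ (mod c)` (`‖c‖ < 1`) — Katz's transport of Dieudonné classes (Thm. 5.1.4) in bounded form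

Topic `Literature/NumberTheory/PAdicHodge` (theorems only; no definition, no named fact, no instance, no `sorry`). Let `K` be a non-archimedean
normed field of characteristic `0`, `R` a commutative ring with a ring map `φ : R → K` of norm `≤ 1` (e.g. `R = 𝒪_D = ℤ_p[ϖ] → ℂ_F`), `c ∈ R`
(e.g. the uniformiser `ϖ`), `W/R` a Weierstrass equation and `E₀/ℤ` an integral one with THE SAME REDUCTION MODULO `c`:
`W ⊗ R/c = (E₀ ⊗ R) ⊗ R/c`. Write `ℓ = log_{E₀} ∈ K⟦X⟧` (`(E₀ ⊗ K).formalLog`) and `F_W ∈ K⟦X, Y⟧` for the chord–tangent law of `W` read in `K`.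

* §1 `norm_natCast_mul_coeff_formalLog_map_le_one` — `ℓ` is LOG-TYPE: `‖n·[Xⁿ]ℓ‖ ≤ 1` (`[Xⁿ]ℓ = c_{n−1}/n` with `c_{n−1} ∈ ℤ` a coefficient of the
  invariant differential); `norm_coeff_map_formalGroupLaw_le_one` (the laws are integral);
* §2 `exists_formalGroupLaw_sub_eq_C_mul_of_map_eq` — `F_W − F_{E₀ ⊗ R} ∈ c·R⟦X,Y⟧` (functoriality of the law under `R → R/c`, tree
  `map_formalGroupLaw`), hence `norm_coeff_map_formalGroupLaw_sub_le`: **`‖[X^d](F_W − F_{E₀})‖ ≤ ‖φ c‖`** in `K`;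
* §3 ★★ `norm_coeff_formalLog_cocycle_le` — **`‖[X^d](ℓ(F_W(X,Y)) − ℓ(X) − ℓ(Y))‖ ≤ M` for every `d`**, for any `M ≥ 0` with
  `‖φ c‖^j ≤ M·‖j‖_K` (`j ≥ 1`) — i.e. `log_{E₀}` is of the second kind for `Ŵ` with cocycle bound `sup_j ‖c‖^j/‖j‖` (Honda's Lemma 2.3 /
  Katz's Key Lemma 5.1.3 in bounded form, `LogTypeSubstCongruence`, applied to `u = F_W ≡ v = F_{E₀}` and `ℓ(F_{E₀}) = ℓ(X) + ℓ(Y)`).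

Purpose (line `kato_lever`, crux K★ `stmt-BirchSwinnertonDyer-22226`, memo `Lines/kato-lever-K2-ramified-cm-transport.md` §5, step «second-kind lemma»):
for the K★ cells `W = W_D` over `𝒪_D = ℤ_p[ϖ]`, `c = ϖ`, `E₀` the CM fibre (`AinfRamifiedDivisionTransport.map_explicitModel_eq_map_cmFibre`):
`log_{E₀}` (and likewise `p⁻¹log_{E₀}(Xᵖ)`) define classes in Katz's `D(Ŵ_D/𝒪_D) ⊗ ℚ`, the module in which the residue (HL)/(H2) of the CM-fibre
transport road is stated. No restriction `e ≤ p − 1` (no divided powers: `M = sup_j ‖ϖ‖^j/‖j‖` is finite for every `e`). BSD / K★ are not proved by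
any of this; nothing about elliptic curves over number fields is proved here.

## References
* N. M. Katz, *Crystalline cohomology, Dieudonné modules, and Jacobi sums* (1981), Key Lemma 5.1.3, Thm. 5.1.4. [Katz1981CrystallineDieudonne]
* T. Honda, *On the theory of commutative formal groups*, J. Math. Soc. Japan 22 (1970), Lemma 2.3. [Honda1970]
* J. H. Silverman, *The Arithmetic of Elliptic Curves* (2009), IV.1, IV.4, IV.5.2, IV.5.5. [SilvermanAEC2009]
-/

noncomputable section

open scoped Classical
open PowerSeries

namespace Literature.NumberTheory.PAdicHodge

open Literature.RingTheory.FormalGroups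

variable {K : Type*} [NormedField K] [IsUltrametricDist K] [CharZero K]
  {R : Type*} [CommRing R] (φ : R →+* K)

/-! ## §1 `log_{E₀}` is log-type; the laws are integral -/

omit [IsUltrametricDist K] in
/-- Over a `ℚ`-algebra, the coefficients of the invariant differential of `E₀ ⊗ K` are images of INTEGERS (those of `formalInvDiff E₀`).
[cite: SilvermanAEC2009, IV.1] -/
theorem coeff_formalOmega_map_eq_intCast (E₀ : WeierstrassCurve ℤ) (k : ℕ) :
    coeff k (E₀.map (Int.castRingHom K)).formalOmega = ((coeff k E₀.formalInvDiff : ℤ) : K) := by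
  rw [← WeierstrassCurve.formalInvDiff_eq_formalOmega, ← WeierstrassCurve.map_formalInvDiff, coeff_map, eq_intCast]

/-- ★ **`log_{E₀}` is LOG-TYPE in `K⟦X⟧`: `‖n·[Xⁿ]log_{E₀}‖ ≤ 1`** (`[Xⁿ]log = c_{n−1}/n`, `c_{n−1} ∈ ℤ`). [cite: SilvermanAEC2009, IV.5.5] -/
theorem norm_natCast_mul_coeff_formalLog_map_le_one (E₀ : WeierstrassCurve ℤ) (n : ℕ) :
    ‖(n : K) * coeff n (E₀.map (Int.castRingHom K)).formalLog‖ ≤ 1 := by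
  rcases n with _ | k
  · rw [Nat.cast_zero, zero_mul, norm_zero]; exact zero_le_one
  · rw [Literature.NumberTheory.EllipticCurves.coeff_succ_formalLog_eq, coeff_formalOmega_map_eq_intCast, ← mul_assoc]
    have hk : ((k : ℚ) + 1) ≠ 0 := by positivity
    have h1 : ((k + 1 : ℕ) : K) * algebraMap ℚ K (1 / ((k : ℚ) + 1)) = 1 := by
      rw [show ((k + 1 : ℕ) : K) = algebraMap ℚ K ((k : ℚ) + 1) by push_cast; rfl, ← map_mul, mul_one_div_cancel hk, map_one]
    rw [h1, one_mul]
    exact IsUltrametricDist.norm_intCast_le_one K _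

omit [IsUltrametricDist K] [CharZero K] in
/-- The chord–tangent law of `W/R` read in `K` is integral when `‖φ‖ ≤ 1`. [cite: SilvermanAEC2009, IV.1] -/
theorem norm_coeff_map_formalGroupLaw_le_one (hφ : ∀ x, ‖φ x‖ ≤ 1) (W : WeierstrassCurve R) (d : Fin 2 →₀ ℕ) :
    ‖MvPowerSeries.coeff d (MvPowerSeries.map φ W.formalGroupLaw)‖ ≤ 1 := by
  rw [MvPowerSeries.coeff_map]; exact hφ _

/-! ## §2 `F_W ≡ F_{E₀} (mod c)` -/

omit [CharZero K] in
/-- **Functoriality of the law under reduction**: if `W₁ ≡ W₂ (mod c)` (as equations over `R/c`) then `F_{W₁} − F_{W₂} ∈ c·R⟦X,Y⟧`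
(`F_{W ⊗ R/c} = F_W ⊗ R/c`, tree `map_formalGroupLaw`). [cite: SilvermanAEC2009, IV.1] -/
theorem exists_formalGroupLaw_sub_eq_C_mul_of_map_eq (c : R) (W₁ W₂ : WeierstrassCurve R)
    (h : W₁.map (Ideal.Quotient.mk (Ideal.span {c})) = W₂.map (Ideal.Quotient.mk (Ideal.span {c}))) :
    ∃ G : MvPowerSeries (Fin 2) R, W₁.formalGroupLaw - W₂.formalGroupLaw = MvPowerSeries.C c * G := by
  have hcoeff : ∀ d, c ∣ MvPowerSeries.coeff d (W₁.formalGroupLaw - W₂.formalGroupLaw) := fun d => by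
    rw [← Ideal.mem_span_singleton, ← Ideal.Quotient.eq_zero_iff_mem, map_sub, map_sub, sub_eq_zero, ← MvPowerSeries.coeff_map,
      ← MvPowerSeries.coeff_map, WeierstrassCurve.map_formalGroupLaw, WeierstrassCurve.map_formalGroupLaw, h]
  refine ⟨fun d => Classical.choose (hcoeff d), MvPowerSeries.ext fun d => ?_⟩
  rw [MvPowerSeries.coeff_C_mul]
  exact Classical.choose_spec (hcoeff d)

omit [IsUltrametricDist K] [CharZero K] in
/-- ★ **`‖[X^d](F_W − F_{E₀ ⊗ R})‖ ≤ ‖φ c‖`** in `K⟦X,Y⟧` when `W ≡ E₀ ⊗ R (mod c)` and `‖φ‖ ≤ 1`. [cite: SilvermanAEC2009, IV.1]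
[cite: Katz1981CrystallineDieudonne, Thm. 5.1.4] -/
theorem norm_coeff_map_formalGroupLaw_sub_le (hφ : ∀ x, ‖φ x‖ ≤ 1) (c : R) (W : WeierstrassCurve R) (E₀ : WeierstrassCurve ℤ)
    (hWE : W.map (Ideal.Quotient.mk (Ideal.span {c})) = (E₀.map (algebraMap ℤ R)).map (Ideal.Quotient.mk (Ideal.span {c})))
    (d : Fin 2 →₀ ℕ) :
    ‖MvPowerSeries.coeff d (MvPowerSeries.map φ W.formalGroupLaw - (E₀.map (Int.castRingHom K)).formalGroupLaw)‖ ≤ ‖φ c‖ := by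
  obtain ⟨G, hG⟩ := exists_formalGroupLaw_sub_eq_C_mul_of_map_eq c W _ hWE
  have hE : (E₀.map (Int.castRingHom K)).formalGroupLaw = MvPowerSeries.map φ ((E₀.map (algebraMap ℤ R)).formalGroupLaw) := by
    have hc : φ.comp (algebraMap ℤ R) = Int.castRingHom K := RingHom.ext_int _ _
    rw [← WeierstrassCurve.map_formalGroupLaw, ← WeierstrassCurve.map_formalGroupLaw, MvPowerSeries.map_map, hc]
  rw [hE, ← map_sub, hG, MvPowerSeries.coeff_map, MvPowerSeries.coeff_C_mul, map_mul, norm_mul]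
  exact mul_le_of_le_one_right (norm_nonneg _) (hφ _)

/-! ## §3 The coboundary of `log_{E₀}` for `⊕_W` is bounded -/

omit [IsUltrametricDist K] in
/-- `log_{E₀}(F_{E₀}(X,Y)) = log_{E₀}(X) + log_{E₀}(Y)` in `K⟦X,Y⟧` (the logarithm is a homomorphism). [cite: SilvermanAEC2009, IV.5.2] -/
theorem formalLog_subst_formalGroupLaw_map_int (E₀ : WeierstrassCurve ℤ) :
    (E₀.map (Int.castRingHom K)).formalLog.subst (E₀.map (Int.castRingHom K)).formalGroupLaw =
      (E₀.map (Int.castRingHom K)).formalLog.subst (MvPowerSeries.X 0 : MvPowerSeries (Fin 2) K) +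
        (E₀.map (Int.castRingHom K)).formalLog.subst (MvPowerSeries.X 1 : MvPowerSeries (Fin 2) K) :=
  (E₀.map (Int.castRingHom K)).formalLog_subst_formalGroupLaw

/-- ★★ **`log_{E₀}` is of the second kind for `Ŵ` when `W ≡ E₀ (mod c)`**: for every multi-index `d`,
`‖[X^d](log_{E₀}(F_W(X,Y)) − log_{E₀}(X) − log_{E₀}(Y))‖ ≤ M` whenever `‖φ c‖^j ≤ M·‖j‖_K` for all `j ≥ 1` (`M = sup_j ‖c‖^j/‖j‖`).
Katz's transport of the Dieudonné class of `log_{E₀}` along the identity `Ŵ ⊗ R/c = Ê₀ ⊗ R/c`, in bounded form (no divided powers on `(c)` needed).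
[cite: Katz1981CrystallineDieudonne, Key Lemma 5.1.3 and Thm. 5.1.4] [cite: Honda1970, Lemma 2.3] -/
theorem norm_coeff_formalLog_cocycle_le (hφ : ∀ x, ‖φ x‖ ≤ 1) (c : R) (W : WeierstrassCurve R) (E₀ : WeierstrassCurve ℤ)
    (hWE : W.map (Ideal.Quotient.mk (Ideal.span {c})) = (E₀.map (algebraMap ℤ R)).map (Ideal.Quotient.mk (Ideal.span {c})))
    {M : ℝ} (hM0 : 0 ≤ M) (hM : ∀ j : ℕ, 1 ≤ j → ‖φ c‖ ^ j ≤ M * ‖(j : K)‖) (d : Fin 2 →₀ ℕ) :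
    ‖MvPowerSeries.coeff d ((E₀.map (Int.castRingHom K)).formalLog.subst (MvPowerSeries.map φ W.formalGroupLaw) -
        (E₀.map (Int.castRingHom K)).formalLog.subst (MvPowerSeries.X 0 : MvPowerSeries (Fin 2) K) -
        (E₀.map (Int.castRingHom K)).formalLog.subst (MvPowerSeries.X 1 : MvPowerSeries (Fin 2) K))‖ ≤ M := by
  rw [sub_sub, ← formalLog_subst_formalGroupLaw_map_int E₀]
  refine norm_coeff_subst_sub_subst_le_of_logType (norm_natCast_mul_coeff_formalLog_map_le_one E₀) ?_ ?_ ?_ (norm_nonneg (φ c)) hM0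
    (norm_coeff_map_formalGroupLaw_sub_le φ hφ c W E₀ hWE) hM d
  · rw [MvPowerSeries.constantCoeff_map, W.constantCoeff_formalGroupLaw, map_zero]
  · exact (E₀.map (Int.castRingHom K)).constantCoeff_formalGroupLaw
  · intro d'
    rw [← WeierstrassCurve.map_formalGroupLaw, MvPowerSeries.coeff_map, eq_intCast]
    exact IsUltrametricDist.norm_intCast_le_one K _

end Literature.NumberTheory.PAdicHodge
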